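import Mathlib
import HarnessLib
import Summits.Ventures.LatticeQCDFlow.Exactness.NCMCGeneralSpaceGammaMethodStudentizedCLT
import Summits.Ventures.LatticeQCDFlow.Exactness.NCMCGeneralSpaceGammaMethodDataWindow

/-!
# The asymptotic variance is NOT degenerate under a one-step minorisation: `σ²_f ≥ (e/(2e + 4)) · Var_π f` for `κ(x, ·) ≥ ε ν` (`e = ε.toReal`); hence `τ_int(setACF κ π A) ≥ e/(4e + 8) > 0` for every event — the positivity hypothesis of the exact-coverage theorems, discharged for rows 8 / 9's certificate shape

HONEST FRAMING: exact (Metropolis-corrected) sampling algorithms for lattice gauge theory;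
figures of merit are autocorrelation/cost numbers at stated couplings and volumes; no
continuum-physics claim.

Venture `LatticeQCDFlow` (cell pub-lqcd), topic `Exactness`; FANOUT row 13 (`eng-snf`, GEN-20).
NEW WORK of the cell, not a published result; no definition is introduced; nothing is cited as a
fact.  The studentized CLT / exact-coverage theorems of GEN-20 (`NCMCGeneralSpaceGammaMethodStudentizedCLT`,
`…OccupancyChainGammaCoverage`, `…GammaMethodIntervalForm`) ASSUME `σ²_f > 0` (resp. `τ_int > 0`).
THIS FILE derives it for the ONE-STEP certificate shape `κ(x, ·) ≥ ε ν` of rows 8 / 9 (heat-bath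
sweeps, the exact flow sampler with a weight bound, row 8's `Scoring.markovChain_clt`), with an
explicit constant and NO almost-everywhere case analysis: with `h` the bounded Poisson solution
`h − κh = f̄` and `q = κ(h²) − (κh)²` the conditional-variance observable, `σ²_f = π(q)` (GEN-19's
martingale form), `q(x) = ∫ (h − κh(x))² dκ(x, ·) ≥ e ∫ (h − κh(x))² dν ≥ e (νh − κh(x))²` (minorisation
+ Jensen), while `Var_π f = ∫ (h − κh)² dπ ≤ 2 ∫ (h − νh)² dπ + 2 ∫ (νh − κh)² dπ` and
`∫ (h − νh)² dπ = π(q) + ∫ (κh − νh)² dπ` (invariance + bias–variance); together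
`Var_π f ≤ (2 + 4/e) σ²_f`.

## Content (`κ` Markov, `π` invariant, `ε • ν ≤ κ(x, ·)` for all `x`, `ν` a probability law,
## `ε ≠ 0`, `e = ε.toReal`; `|f| ≤ C` measurable, `f̄ = f − πf`, `σ²_f = C_f̄(0) + 2 Σ' C_f̄(t+1)`)

* `kop_sq_sub_sq_eq_integral` — `κ(g²)(x) − (κg(x))² = ∫ (g − κg(x))² dκ(x, ·)` (any bounded measurable `g`);
  `kop_sqDev_eq` — `κ((g − b)²)(x) = (κ(g²)(x) − (κg(x))²) + (κg(x) − b)²`.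
* `sq_integral_le_integral_sq` — `(∫ g dμ)² ≤ ∫ g² dμ` on a probability space (bounded measurable `g`).
* **`greenKubo_variance_ge_of_minorised`** — `(e/(2e + 4)) · ∫ f̄² dπ ≤ σ²_f`.
* **`tauInt_setACF_pos_of_minorised`** — for `0 < π(A) < 1`: `e/(4e + 8) ≤ Scoring.tauInt (setACF κ π A)`,
  in particular `0 < τ_int`.

NOT CLAIMED: the `m`-step (Doeblin POWER) version — for the NCMC lane's two-step certificate the
positivity of `τ_int(ρ_occ)` stays a hypothesis; sharp constants; unbounded observables.
-/

namespace Summit.Ventures.LatticeQCDFlow.Exactness.GeneralNCMC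

open MeasureTheory ProbabilityTheory Set Filter Finset
open scoped ENNReal NNReal Topology

variable {S : Type*} [MeasurableSpace S]

/-! ## §1 Pointwise identities for the transition operator -/

section Pointwise

variable (κ : Kernel S S) [IsMarkovKernel κ]

/-- **Conditional variance as an integral of squared deviations**: for bounded measurable `g`,
`κ(g²)(x) − (κg(x))² = ∫ (g(y) − κg(x))² κ(x, dy)`. -/
theorem kop_sq_sub_sq_eq_integral {g : S → ℝ} (hg : Measurable g) {Cg : ℝ} (hCg : ∀ x, |g x| ≤ Cg)
    (x : S) :
    Scoring.kop κ (fun y => g y ^ 2) x - (Scoring.kop κ g x) ^ 2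
      = ∫ y, (g y - Scoring.kop κ g x) ^ 2 ∂(κ x) := by
  have hCg0 : 0 ≤ Cg := (abs_nonneg _).trans (hCg x)
  have hi1 : Integrable (fun y => g y ^ 2) (κ x) :=
    Scoring.integrable_of_bounded _ (hg.pow_const 2) (C := Cg ^ 2) fun y => by
      rw [abs_pow]; exact pow_le_pow_left₀ (abs_nonneg _) (hCg y) 2
  have hi2 : Integrable (fun y => g y) (κ x) := Scoring.integrable_of_bounded _ hg hCg
  set a := Scoring.kop κ g x with ha
  have hexp : (fun y => (g y - a) ^ 2) = fun y => g y ^ 2 - 2 * a * g y + a ^ 2 := by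
    funext y; ring
  have hi3 : Integrable (fun y => g y ^ 2 - 2 * a * g y) (κ x) := hi1.sub (hi2.const_mul _)
  rw [hexp, integral_add hi3 (integrable_const _),
    integral_sub hi1 (hi2.const_mul _), integral_const_mul, integral_const, probReal_univ, one_smul]
  unfold Scoring.kop at ha ⊢
  rw [← ha]
  ring

/-- **Bias–variance for the transition operator**: `κ((g − b)²)(x) = (κ(g²)(x) − (κg(x))²) + (κg(x) − b)²`. -/
theorem kop_sqDev_eq {g : S → ℝ} (hg : Measurable g) {Cg : ℝ} (hCg : ∀ x, |g x| ≤ Cg) (b : ℝ)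
    (x : S) :
    Scoring.kop κ (fun y => (g y - b) ^ 2) x
      = (Scoring.kop κ (fun y => g y ^ 2) x - (Scoring.kop κ g x) ^ 2) + (Scoring.kop κ g x - b) ^ 2 := by
  have hi1 : Integrable (fun y => g y ^ 2) (κ x) :=
    Scoring.integrable_of_bounded _ (hg.pow_const 2) (C := Cg ^ 2) fun y => by
      rw [abs_pow]; exact pow_le_pow_left₀ (abs_nonneg _) (hCg y) 2
  have hi2 : Integrable (fun y => g y) (κ x) := Scoring.integrable_of_bounded _ hg hCg
  have hexp : (fun y => (g y - b) ^ 2) = fun y => g y ^ 2 - 2 * b * g y + b ^ 2 := by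
    funext y; ring
  have hi3 : Integrable (fun y => g y ^ 2 - 2 * b * g y) (κ x) := hi1.sub (hi2.const_mul _)
  unfold Scoring.kop
  rw [hexp, integral_add hi3 (integrable_const _),
    integral_sub hi1 (hi2.const_mul _), integral_const_mul, integral_const, probReal_univ, one_smul]
  ring

end Pointwise

/-- `(∫ g dμ)² ≤ ∫ g² dμ` for a bounded measurable `g` on a probability space. -/
theorem sq_integral_le_integral_sq {Ω₀ : Type*} [MeasurableSpace Ω₀] (μ : Measure Ω₀)
    [IsProbabilityMeasure μ] {g : Ω₀ → ℝ} (hg : Measurable g) {B : ℝ} (hB : ∀ x, |g x| ≤ B) :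
    (∫ x, g x ∂μ) ^ 2 ≤ ∫ x, g x ^ 2 ∂μ := by
  have h1 : |∫ x, g x ∂μ| ≤ ∫ x, |g x| ∂μ := abs_integral_le_integral_abs
  have h2 := integral_abs_le_sqrt_integral_sq μ hg hB
  have h3 : 0 ≤ ∫ x, g x ^ 2 ∂μ := integral_nonneg fun x => sq_nonneg _
  calc (∫ x, g x ∂μ) ^ 2 = |∫ x, g x ∂μ| ^ 2 := (sq_abs _).symm
    _ ≤ (Real.sqrt (∫ x, g x ^ 2 ∂μ)) ^ 2 :=
        pow_le_pow_left₀ (abs_nonneg _) (h1.trans h2) 2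
    _ = ∫ x, g x ^ 2 ∂μ := Real.sq_sqrt h3

/-! ## §2 The lower bound -/

section LowerBound

variable {κ : Kernel S S} [IsMarkovKernel κ] {π : Measure S} [IsProbabilityMeasure π]
  {ν : Measure S} [IsProbabilityMeasure ν] {ε : ℝ≥0∞}

/-- **THE ASYMPTOTIC VARIANCE DOMINATES A MULTIPLE OF THE STATIC VARIANCE** under a one-step
minorisation: `κ` Markov, `π` invariant, `ε • ν ≤ κ(x, ·)` for all `x` (`ε ≠ 0`), `|f| ≤ C`
measurable, `e = ε.toReal`.  Then
`(e/(2e + 4)) · ∫ (f − πf)² dπ ≤ C_f̄(0) + 2 Σ'_t C_f̄(t+1) = σ²_f`. -/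
theorem greenKubo_variance_ge_of_minorised (hπ : Kernel.Invariant κ π) (hε : ε ≠ 0)
    (hmin : ∀ z, ε • ν ≤ κ z) {f : S → ℝ} (hf : Measurable f) {C : ℝ} (hC : ∀ x, |f x| ≤ C) :
    ε.toReal / (2 * ε.toReal + 4) * ∫ y, (f y - ∫ z, f z ∂π) ^ 2 ∂π
      ≤ Scoring.autocov κ π (fun y => f y - ∫ z, f z ∂π) 0
        + 2 * ∑' t, Scoring.autocov κ π (fun y => f y - ∫ z, f z ∂π) (t + 1) := by
  haveI : Nonempty S := nonempty_of_isProbabilityMeasure π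
  -- the one-step minorisation as a `nHit κ 1` minorisation
  have hmin1 : ∀ z, ε • ν ≤ nHit κ 1 z := fun z => by rw [nHit_one]; exact hmin z
  have hε1 : ε ≤ 1 := by
    haveI := isMarkovKernel_nHit κ 1
    exact eps_le_one_of_minorised hmin1
  have hε0 : 0 < ε := pos_iff_ne_zero.2 hε
  have hminS : ∀ x {B : Set S}, MeasurableSet B → ε * ν B ≤ nHit κ 1 x B :=
    fun z B hB => minorised_setwise hmin1 z hB
  have hεtop : ε ≠ ∞ := ne_top_of_le_ne_top ENNReal.one_ne_top hε1
  have he : 0 < ε.toReal := ENNReal.toReal_pos hε0.ne' hεtop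
  set c := ∫ z, f z ∂π with hc
  obtain ⟨hfb, hCfb, hfb0⟩ := Scoring.centred_observable_bounds π hf hC
  rw [← hc] at hfb hCfb hfb0
  -- the Poisson solution and the martingale form of the asymptotic variance
  obtain ⟨h, hhm, hhb, hpois⟩ := poisson_exists_of_nHit hminS hε0 hε1 Nat.one_pos hπ hfb hCfb hfb0
  set Ch : ℝ := 2 * (2 * C) * (1 : ℕ) / ε.toReal with hCh
  have hGK := integral_sq_sub_sq_kop_eq_greenKubo_of_nHit hminS hε0 hε1 Nat.one_pos hπ hfb hCfb hfb0
    hhm hhb hpois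
  -- `σ² = ∫ h² − ∫ (κh)²`; rewrite the target's `autocov … 0` as `∫ f̄²`
  have h0 : Scoring.autocov κ π (fun y => f y - c) 0 = ∫ y, (f y - c) ^ 2 ∂π := by
    unfold Scoring.autocov
    simp only [Function.iterate_zero, id_eq, sq]
  rw [h0, ← hGK]
  -- abbreviations
  obtain ⟨hKm, hKb⟩ := Scoring.iterate_kop_bounded_measurable κ hhm hhb 1
  simp only [Function.iterate_one] at hKm hKb
  have hCh0 : 0 ≤ Ch := le_trans (abs_nonneg _) (hhb (Classical.choice ‹Nonempty S›))
  set a : ℝ := ∫ y, h y ∂ν with ha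
  -- q(x) = κ(h²)(x) − (κh(x))², with π(q) = ∫h² − ∫(κh)²
  have hq_int : ∫ x, (Scoring.kop κ (fun y => h y ^ 2) x - (Scoring.kop κ h x) ^ 2) ∂π
      = ∫ x, h x ^ 2 ∂π - ∫ x, (Scoring.kop κ h x) ^ 2 ∂π := by
    have hh2m : Measurable fun y => h y ^ 2 := hhm.pow_const 2
    have hh2b : ∀ y, |h y ^ 2| ≤ Ch ^ 2 := fun y => by
      rw [abs_pow]; exact pow_le_pow_left₀ (abs_nonneg _) (hhb y) 2
    rw [integral_sub (Scoring.integrable_of_bounded π (Scoring.measurable_kop κ hh2m)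
        (Scoring.abs_kop_le κ hh2b))
      (Scoring.integrable_of_bounded π (hKm.pow_const 2) (C := Ch ^ 2) fun y => by
        rw [abs_pow]; exact pow_le_pow_left₀ (abs_nonneg _) (hKb y) 2),
      Scoring.integral_kop κ hπ hh2m hh2b]
  -- lower bound on q(x): `q(x) ≥ e (a − κh(x))²`
  have hq_ge : ∀ x, ε.toReal * (a - Scoring.kop κ h x) ^ 2
      ≤ Scoring.kop κ (fun y => h y ^ 2) x - (Scoring.kop κ h x) ^ 2 := by
    intro x
    rw [kop_sq_sub_sq_eq_integral κ hhm hhb x]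
    have hgm : Measurable fun y => (h y - Scoring.kop κ h x) ^ 2 := (hhm.sub measurable_const).pow_const 2
    have hgb : ∀ y, |(h y - Scoring.kop κ h x) ^ 2| ≤ (Ch + Ch) ^ 2 := fun y => by
      rw [abs_pow]
      exact pow_le_pow_left₀ (abs_nonneg _) ((abs_sub _ _).trans (add_le_add (hhb y) (hKb x))) 2
    -- minorisation: `∫ g dκ(x) ≥ ∫ g d(ε ν) = e ∫ g dν`
    have hmono : ∫ y, (h y - Scoring.kop κ h x) ^ 2 ∂(ε • ν)
        ≤ ∫ y, (h y - Scoring.kop κ h x) ^ 2 ∂(κ x) :=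
      integral_mono_measure (hmin x) (ae_of_all _ fun y => sq_nonneg _)
        (Scoring.integrable_of_bounded _ hgm hgb)
    rw [integral_smul_measure, smul_eq_mul] at hmono
    -- Jensen under `ν`: `∫ (h − b)² dν ≥ (∫ (h − b) dν)² = (a − b)²`
    have hjen : (a - Scoring.kop κ h x) ^ 2 ≤ ∫ y, (h y - Scoring.kop κ h x) ^ 2 ∂ν := by
      have hj := sq_integral_le_integral_sq ν (g := fun y => h y - Scoring.kop κ h x)
        (hhm.sub measurable_const) (B := Ch + Ch)
        (fun y => (abs_sub _ _).trans (add_le_add (hhb y) (hKb x)))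
      rwa [integral_sub (Scoring.integrable_of_bounded ν hhm hhb) (integrable_const _), integral_const,
        probReal_univ, one_smul, ← ha] at hj
    exact (mul_le_mul_of_nonneg_left hjen he.le).trans hmono
  -- (1) `e ∫ (a − κh)² dπ ≤ σ²`
  have hDm : Measurable fun x => (a - Scoring.kop κ h x) ^ 2 := (measurable_const.sub hKm).pow_const 2
  have hDb : ∀ x, |(a - Scoring.kop κ h x) ^ 2| ≤ (Ch + Ch) ^ 2 := fun x => by
    rw [abs_pow]
    refine pow_le_pow_left₀ (abs_nonneg _) ((abs_sub _ _).trans (add_le_add ?_ (hKb x))) 2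
    rw [ha, ← Real.norm_eq_abs]
    calc ‖∫ y, h y ∂ν‖ ≤ Ch * ν.real univ := norm_integral_le_of_norm_le_const
          (Eventually.of_forall fun y => by rw [Real.norm_eq_abs]; exact hhb y)
      _ = Ch := by rw [probReal_univ, mul_one]
  have hiD : Integrable (fun x => (a - Scoring.kop κ h x) ^ 2) π := Scoring.integrable_of_bounded π hDm hDb
  have hqm : Measurable fun x => Scoring.kop κ (fun y => h y ^ 2) x - (Scoring.kop κ h x) ^ 2 :=
    (Scoring.measurable_kop κ (hhm.pow_const 2)).sub (hKm.pow_const 2)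
  have hqb : ∀ x, |Scoring.kop κ (fun y => h y ^ 2) x - (Scoring.kop κ h x) ^ 2| ≤ Ch ^ 2 + Ch ^ 2 :=
    fun x => (abs_sub _ _).trans (add_le_add
      (Scoring.abs_kop_le κ (fun y => by
        rw [abs_pow]; exact pow_le_pow_left₀ (abs_nonneg _) (hhb y) 2) x)
      (by rw [abs_pow]; exact pow_le_pow_left₀ (abs_nonneg _) (hKb x) 2))
  have hiq : Integrable (fun x => Scoring.kop κ (fun y => h y ^ 2) x - (Scoring.kop κ h x) ^ 2) π :=
    Scoring.integrable_of_bounded π hqm hqb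
  have h1 : ε.toReal * ∫ x, (a - Scoring.kop κ h x) ^ 2 ∂π
      ≤ ∫ x, h x ^ 2 ∂π - ∫ x, (Scoring.kop κ h x) ^ 2 ∂π := by
    rw [← hq_int, ← integral_const_mul]
    exact integral_mono (hiD.const_mul _) hiq hq_ge
  -- (3) `∫ (h − a)² dπ = σ² + ∫ (κh − a)² dπ`
  have h3 : ∫ x, (h x - a) ^ 2 ∂π
      = (∫ x, h x ^ 2 ∂π - ∫ x, (Scoring.kop κ h x) ^ 2 ∂π) + ∫ x, (Scoring.kop κ h x - a) ^ 2 ∂π := by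
    have hdm : Measurable fun y => (h y - a) ^ 2 := (hhm.sub measurable_const).pow_const 2
    have hdb : ∀ y, |(h y - a) ^ 2| ≤ (Ch + Ch) ^ 2 := fun y => by
      rw [abs_pow]
      refine pow_le_pow_left₀ (abs_nonneg _) ((abs_sub _ _).trans (add_le_add (hhb y) ?_)) 2
      rw [ha, ← Real.norm_eq_abs]
      calc ‖∫ y, h y ∂ν‖ ≤ Ch * ν.real univ := norm_integral_le_of_norm_le_const
            (Eventually.of_forall fun y => by rw [Real.norm_eq_abs]; exact hhb y)
        _ = Ch := by rw [probReal_univ, mul_one]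
    rw [← Scoring.integral_kop κ hπ hdm hdb]
    have hpt : ∀ x, Scoring.kop κ (fun y => (h y - a) ^ 2) x
        = (Scoring.kop κ (fun y => h y ^ 2) x - (Scoring.kop κ h x) ^ 2)
          + (Scoring.kop κ h x - a) ^ 2 := fun x => kop_sqDev_eq κ hhm hhb a x
    rw [integral_congr_ae (ae_of_all _ hpt), integral_add hiq, hq_int]
    exact Scoring.integrable_of_bounded π ((hKm.sub measurable_const).pow_const 2) (C := (Ch + Ch) ^ 2)
      fun x => by
        rw [abs_pow]
        refine pow_le_pow_left₀ (abs_nonneg _) ((abs_sub _ _).trans (add_le_add (hKb x) ?_)) 2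
        rw [ha, ← Real.norm_eq_abs]
        calc ‖∫ y, h y ∂ν‖ ≤ Ch * ν.real univ := norm_integral_le_of_norm_le_const
              (Eventually.of_forall fun y => by rw [Real.norm_eq_abs]; exact hhb y)
          _ = Ch := by rw [probReal_univ, mul_one]
  -- (2) `Var_π f = ∫ (h − κh)² ≤ 2 ∫ (h − a)² + 2 ∫ (a − κh)²`
  have hsym : ∫ x, (Scoring.kop κ h x - a) ^ 2 ∂π = ∫ x, (a - Scoring.kop κ h x) ^ 2 ∂π :=
    integral_congr_ae (ae_of_all _ fun x => by ring)
  have h2 : ∫ y, (f y - c) ^ 2 ∂π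
      ≤ 2 * ∫ x, (h x - a) ^ 2 ∂π + 2 * ∫ x, (a - Scoring.kop κ h x) ^ 2 ∂π := by
    have hpt : ∀ x, (f x - c) ^ 2 ≤ 2 * (h x - a) ^ 2 + 2 * (a - Scoring.kop κ h x) ^ 2 := by
      intro x
      rw [← hpois x]
      nlinarith [sq_nonneg (h x - a - (a - Scoring.kop κ h x))]
    have hia : Integrable (fun x => (h x - a) ^ 2) π :=
      Scoring.integrable_of_bounded π ((hhm.sub measurable_const).pow_const 2) (C := (Ch + Ch) ^ 2)
        fun y => by
          rw [abs_pow]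
          refine pow_le_pow_left₀ (abs_nonneg _) ((abs_sub _ _).trans (add_le_add (hhb y) ?_)) 2
          rw [ha, ← Real.norm_eq_abs]
          calc ‖∫ y, h y ∂ν‖ ≤ Ch * ν.real univ := norm_integral_le_of_norm_le_const
                (Eventually.of_forall fun y => by rw [Real.norm_eq_abs]; exact hhb y)
            _ = Ch := by rw [probReal_univ, mul_one]
    calc ∫ y, (f y - c) ^ 2 ∂π ≤ ∫ x, (2 * (h x - a) ^ 2 + 2 * (a - Scoring.kop κ h x) ^ 2) ∂π :=
          integral_mono (Scoring.integrable_of_bounded π (hfb.pow_const 2) (C := (2 * C) ^ 2) fun y => by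
            rw [abs_pow]; exact pow_le_pow_left₀ (abs_nonneg _) (hCfb y) 2)
            ((hia.const_mul 2).add (hiD.const_mul 2)) hpt
      _ = 2 * ∫ x, (h x - a) ^ 2 ∂π + 2 * ∫ x, (a - Scoring.kop κ h x) ^ 2 ∂π := by
          rw [integral_add (hia.const_mul 2) (hiD.const_mul 2), integral_const_mul, integral_const_mul]
  -- combine: Var ≤ 2σ² + 4 D, e D ≤ σ²
  set σ2 := ∫ x, h x ^ 2 ∂π - ∫ x, (Scoring.kop κ h x) ^ 2 ∂π with hσ2
  set D := ∫ x, (a - Scoring.kop κ h x) ^ 2 ∂π with hD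
  have hD0 : 0 ≤ D := integral_nonneg fun x => sq_nonneg _
  have hV : ∫ y, (f y - c) ^ 2 ∂π ≤ 2 * σ2 + 4 * D := by
    rw [h3, hsym] at h2; linarith
  have hV0 : 0 ≤ ∫ y, (f y - c) ^ 2 ∂π := integral_nonneg fun x => sq_nonneg _
  rw [div_mul_eq_mul_div, div_le_iff₀ (by linarith)]
  nlinarith [h1, hV, hD0, he]

/-- **Every event has a positive integrated autocorrelation time under a one-step minorisation**:
for `0 < π(A) < 1`, `e/(4e + 8) ≤ Scoring.tauInt (setACF κ π A)` (`e = ε.toReal > 0`). -/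
theorem tauInt_setACF_pos_of_minorised (hπ : Kernel.Invariant κ π) (hε : ε ≠ 0)
    (hmin : ∀ z, ε • ν ≤ κ z) {A : Set S} (hA : MeasurableSet A) (h0 : 0 < π.real A)
    (h1 : π.real A < 1) :
    ε.toReal / (4 * ε.toReal + 8) ≤ Scoring.tauInt (setACF κ π A)
      ∧ 0 < Scoring.tauInt (setACF κ π A) := by
  haveI : Nonempty S := nonempty_of_isProbabilityMeasure π
  have hmin1 : ∀ z, ε • ν ≤ nHit κ 1 z := fun z => by rw [nHit_one]; exact hmin z
  have hε1 : ε ≤ 1 := by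
    haveI := isMarkovKernel_nHit κ 1
    exact eps_le_one_of_minorised hmin1
  have hεtop : ε ≠ ∞ := ne_top_of_le_ne_top ENNReal.one_ne_top hε1
  have he : 0 < ε.toReal := ENNReal.toReal_pos hε hεtop
  have hf : Measurable (A.indicator (1 : S → ℝ)) := measurable_one.indicator hA
  have hC : ∀ y, |A.indicator (1 : S → ℝ) y| ≤ 1 := fun y => by
    by_cases hy : y ∈ A <;> simp [hy]
  have hmean : ∫ z, A.indicator (1 : S → ℝ) z ∂π = π.real A := integral_indicator_one hA
  have hvar : ∫ y, (A.indicator (1 : S → ℝ) y - ∫ z, A.indicator 1 z ∂π) ^ 2 ∂π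
      = π.real A * (1 - π.real A) := by
    have h := autocov_centredIndicator_eq_setAutocov hπ hA 0
    rw [setAutocov_zero hA] at h
    rw [hmean, ← h]
    unfold Scoring.autocov
    simp only [Function.iterate_zero, id_eq, sq]
  have hσ : Scoring.autocov κ π (fun y => A.indicator (1 : S → ℝ) y - ∫ z, A.indicator 1 z ∂π) 0
      + 2 * ∑' t, Scoring.autocov κ π
        (fun y => A.indicator (1 : S → ℝ) y - ∫ z, A.indicator 1 z ∂π) (t + 1)
      = 2 * Scoring.tauInt (setACF κ π A) * (π.real A * (1 - π.real A)) := by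
    rw [← cltVariance_eq_autocov κ π, greenKubo_indicator_eq_tauInt hπ hA h0 h1]
  have hmain := greenKubo_variance_ge_of_minorised hπ hε hmin hf hC
  rw [hvar, hσ] at hmain
  have hv0 : 0 < π.real A * (1 - π.real A) := mul_pos h0 (sub_pos.2 h1)
  have hlow : ε.toReal / (4 * ε.toReal + 8) ≤ Scoring.tauInt (setACF κ π A) := by
    rw [div_le_iff₀ (by linarith)]
    have h' : ε.toReal / (2 * ε.toReal + 4) ≤ 2 * Scoring.tauInt (setACF κ π A) :=
      le_of_mul_le_mul_right (by linarith [hmain]) hv0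
    rw [div_le_iff₀ (by linarith)] at h'
    linarith
  exact ⟨hlow, lt_of_lt_of_le (by positivity) hlow⟩

end LowerBound

end Summit.Ventures.LatticeQCDFlow.Exactness.GeneralNCMC
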